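import Summits.QuantumFields.YangMills.Theorems.LuscherReductionTwistedTraceScalingBOMassRatio
import Summits.QuantumFields.YangMills.Theorems.LuscherReductionTwistedTraceScalingVacuumHodge
import HarnessLib

/-!
# The fibre-mass ratio `M₂^γ ≤ 2·M₂^{γ,in}` UNCONDITIONALLY: the Hodge hypothesis (H) of `…BOShellCoercive` / `…BOMassRatio` is the landed `…VacuumHodge.ker_covCurl_one_le`
# (lane A of S-BASE, crux `TwistedTraceScaling` stmt-QuantumFields-20203, C4-CORE, the (OD) pen; `pub/ym-fleet/ym-luscher-20007-p1/COARSE-DESIGN.md` §30.4)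

`…BOShellCoercive.shell_exponent_ge_of_hodge`, `…shell_gauss_le_of_hodge` and `…BOMassRatio.massRatio_le_two_of_hodge` were proved under
(H) `LinearMap.ker (covCurl 1) ≤ constModes L ⊔ gaugeModes L`; the pooled prover's `…VacuumHodge.ker_covCurl_one_le` (discrete Poincaré lemma on `(ℤ/L)³`) IS (H), so:
* `shell_exponent_ge`, `shell_gauss_le` — the stiff Gaussian dominates `t·gap(L)·‖x − P_Γx‖²` on the balanced transverse space, and the full integrand is `≤ e^{−min(1/s², 2t·gap)‖x‖²}`;
* ★★ `massRatio_le_two (hL : 2 ≤ L)` — eventually in `β`, `∫_{‖x‖ ≤ r_f} e^{−2q_{β/2,β}}e^{−‖P_Γx‖²/β^{-2}} dπ ≤ 2·∫_{‖x‖ ≤ r_f/12} (same)`, `r_f = min (1/40) (β^{-1/2}·btLog β)` — the factor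
  `M₂^γ/M₂^{γ,in} ≤ 2` in the (C4)-core rate `b_core` (COARSE-DESIGN §30.2).
HONEST FRAMING: bookkeeping for a stub of a child of the CONDITIONAL route R2b1; (C5), the final `b`, (B-ST), C4-CORE OPEN; not a gap, not Clay.
-/

set_option autoImplicit false

noncomputable section

open MeasureTheory Filter Topology Real
open scoped BigOperators InnerProductSpace RealInnerProductSpace
open Literature.MathematicalPhysics.QuantumFieldTheory
open Literature.MathematicalPhysics.QuantumLattice

namespace Summit.QuantumFields.YangMills.Theorems.FemtoTransferGap.TwoLattice.ConstTube

open Summit.QuantumFields.YangMills.Theorems.FemtoTransferGap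
open Summit.QuantumFields.YangMills.Theorems.FemtoTransferGap.TwoLattice
open Summit.QuantumFields.YangMills.Theorems.FemtoTransferGap.TwoLattice.Toron
open Summit.QuantumFields.YangMills.Theorems.FemtoTransferGap.TwoLattice.Stiff
open Summit.QuantumFields.YangMills.Theorems.FemtoTransferGap.TwoLattice.Cov

variable {L : ℕ} [NeZero L]

/-- ★ **Stiff coercivity on the balanced transverse space, unconditionally**: for `x ⟂ constModes`, `t·(2 − 2cos(2π/L))·‖x − P_Γx‖² ≤ q_{t,b}(x)` and
`‖x‖² = ‖P_Γx‖² + ‖x − P_Γx‖²`. [cite: Luscher1983, §3] -/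
theorem shell_exponent_ge (hL : 2 ≤ L) {t : ℝ} (ht : 0 ≤ t) {b : ℝ} (hb : 0 ≤ b) {x : LinkSpace L} (hx : ∀ c ∈ constModes L, ⟪c, x⟫ = 0) :
    t * (2 - 2 * Real.cos (2 * Real.pi / L)) * ‖x - (gaugeModes L).starProjection x‖ ^ 2 ≤ stiffGaussExp L t b x ∧
      ‖x‖ ^ 2 = ‖(gaugeModes L).starProjection x‖ ^ 2 + ‖x - (gaugeModes L).starProjection x‖ ^ 2 :=
  shell_exponent_ge_of_hodge hL ker_covCurl_one_le ht hb hx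

/-- ★ **The shell integrand is a full Gaussian, unconditionally**: `e^{−‖P_Γx‖²/s²}·e^{−2q_{t,b}(x)} ≤ e^{−min(1/s², 2t(2 − 2cos(2π/L)))·‖x‖²}` for `x ⟂ constModes`.
[cite: Luscher1983, §3] -/
theorem shell_gauss_le (hL : 2 ≤ L) {t : ℝ} (ht : 0 ≤ t) {b : ℝ} (hb : 0 ≤ b) (s : ℝ) {x : LinkSpace L} (hx : ∀ c ∈ constModes L, ⟪c, x⟫ = 0) :
    Real.exp (-(‖(gaugeModes L).starProjection x‖ ^ 2 / s ^ 2)) * Real.exp (-(stiffGaussExp L t b x)) ^ 2 ≤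
      Real.exp (-(min (1 / s ^ 2) (2 * t * (2 - 2 * Real.cos (2 * Real.pi / L))) * ‖x‖ ^ 2)) :=
  shell_gauss_le_of_hodge hL ker_covCurl_one_le ht hb s hx

/-- ★★ **THE FIBRE-MASS RATIO IS AT MOST TWO, unconditionally** (`L ≥ 2`): eventually in `β`,
`∫ 𝟙_{‖x‖ ≤ r_f}·e^{−2q}·e^{−‖P_Γx‖²/β^{-2}} dπ ≤ 2·∫ 𝟙_{‖x‖ ≤ r_f/12}·e^{−2q}·e^{−‖P_Γx‖²/β^{-2}} dπ`, `r_f = min (1/40) (β^{-1/2}·btLog β)`. [cite: Luscher1983, §3] -/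
theorem massRatio_le_two (hL : 2 ≤ L) :
    ∀ᶠ β : ℝ in atTop,
      ∫ v, {v : Edge 3 L → Fin 3 → ℝ | ‖linkEmbed L v‖ ≤ min (1 / 40) (powScale (1 / 2) β * btLog β)}.indicator (fun _ => (1 : ℝ)) v *
          (Real.exp (-(stiffGaussExp L (β / 2) β (linkEmbed L v))) ^ 2 * Real.exp (-(‖(gaugeModes L).starProjection (linkEmbed L v)‖ ^ 2 / powScale 1 β ^ 2))) ∂orthoTransverse L ≤
        2 * ∫ v, {v : Edge 3 L → Fin 3 → ℝ | ‖linkEmbed L v‖ ≤ min (1 / 40) (powScale (1 / 2) β * btLog β) / 12}.indicator (fun _ => (1 : ℝ)) v *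
          (Real.exp (-(stiffGaussExp L (β / 2) β (linkEmbed L v))) ^ 2 * Real.exp (-(‖(gaugeModes L).starProjection (linkEmbed L v)‖ ^ 2 / powScale 1 β ^ 2))) ∂orthoTransverse L :=
  massRatio_le_two_of_hodge hL ker_covCurl_one_le

end Summit.QuantumFields.YangMills.Theorems.FemtoTransferGap.TwoLattice.ConstTube

end
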